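import Summits.CriticalPhenomena.Ising3D.IsingStripL11Cover
import HarnessLib

/-!
# F-CP1: the three rational fields of `StripCertificatesL11 stair cover` by ONE `decide +kernel` each
(cell `crit-ising-boot`, seat typing-1; PRE-REG v5 `b8848a1d5c9e4d5a` §(1a) AMEND-6; sibling of `IsingStripL11Cover`)

HONEST FRAMING: lottery ticket; floor = tightest certified 3D Ising CFT bounds; floating SDPB islands are not
certificates; nothing here is a bootstrap certificate — the elementary cover step only.

`StripL11.WQ₁₁ / BQ₁₁ / SQ₁₁ / SplusQ₁₁` are the pre-registered literals `W₁₁`, `B₁₁`, `S₁₁`, `S₁₁plus` as rational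
data (`W₁₁_eq`, `B₁₁_eq`, `S₁₁_eq`, `S₁₁plus_eq`). Dischargers: `StripL11.covers_of_cert` (certificate run with
un-excluded list `BQ₁₁ :: stair`, no band, tiles `cover` ⇒ `W₁₁ \ (B₁₁ ∪ ⋃ stair) ⊆ ⋃ cover`),
`StripL11.stair_sup_of_cert` (`ub = stair`, band `SQ₁₁`, no tiles ⇒ `S₁₁ ⊆ ⋃ stair`), `StripL11.stair_sub_of_check`
(`stairSubCheck WQ₁₁ SplusQ₁₁ stair` ⇒ `⋃ stair ⊆ S₁₁plus`), assembled with the `excluded` clauses in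
`StripL11.stripCertificatesL11_of_certs : … → StripCertificatesL11 stair cover`; and the K4 (a) FACE shape of AMEND-7 (O4):
the layers `layerLeft/Right/Bottom/Top d` (`L_s(d)`) and `StripL11.face_of_cert : … → IsingEnclosure W₁₁ ((B₁₁ ∪ ⋃ stair) ∪
(W₁₁ \\ L))` from a certificate run on the layer, with the staircase-PINNED reader form `face_envelope_of_certs`
(adds the `stair_sup`/`stair_sub` certificates and concludes also `IsingEnclosure W₁₁ ((B₁₁ ∪ S₁₁plus) ∪ (W₁₁ \\ L))`). Smoke tests at the end (shape
tests by `decide +kernel`, not staircases or tilings of record — those are hash-rowed by the lead / producers and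
land in their own instance file). [folklore]
-/

namespace Summit.CriticalPhenomena.Ising3D

open Set Literature.MathematicalPhysics.QuantumFieldTheory.ConformalBootstrap3D

namespace StripL11

/-! ### The F-CP1 strip instance: `W₁₁`, `B₁₁`, `S₁₁`, `S₁₁plus` as rational data; the three dischargers -/

/-- `W₁₁` as a rational box. [folklore] -/
def WQ₁₁ : BoxQ := ⟨101 / 200, 107 / 200, 6 / 5, 8 / 5⟩

/-- `B₁₁` as a rational box. [folklore] -/
def BQ₁₁ : BoxQ := ⟨263 / 512, 67 / 128, 89 / 64, 185 / 128⟩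

/-- `S₁₁` as rational band data: cut `521/1000`, centre line `36/25 + (24/5)(Δσ − 209/400)`, half-width `3/100`.
[folklore] -/
def SQ₁₁ : StripQ := ⟨521 / 1000, 36 / 25, 24 / 5, 209 / 400, 3 / 100⟩

/-- `S₁₁plus` as rational band data: cut `519/1000`, same centre line, half-width `1/25`. [folklore] -/
def SplusQ₁₁ : StripQ := ⟨519 / 1000, 36 / 25, 24 / 5, 209 / 400, 1 / 25⟩

/-- `W₁₁ = WQ₁₁.toSet`. [folklore] -/
theorem W₁₁_eq : W₁₁ = WQ₁₁.toSet := by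
  simp only [W₁₁, WQ₁₁, BoxQ.toSet]
  push_cast
  rfl

/-- `B₁₁ = BQ₁₁.toSet`. [folklore] -/
theorem B₁₁_eq : B₁₁ = BQ₁₁.toSet := by
  simp only [B₁₁, BQ₁₁, BoxQ.toSet]
  push_cast
  rfl

/-- `S₁₁ = SQ₁₁.toSet WQ₁₁`. [folklore] -/
theorem S₁₁_eq : S₁₁ = SQ₁₁.toSet WQ₁₁ := by
  simp only [S₁₁, StripQ.toSet, StripQ.core, SQ₁₁, W₁₁_eq, mem_setOf_eq]
  push_cast
  rfl

/-- `S₁₁plus = SplusQ₁₁.toSet WQ₁₁`. [folklore] -/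
theorem S₁₁plus_eq : S₁₁plus = SplusQ₁₁.toSet WQ₁₁ := by
  simp only [S₁₁plus, StripQ.toSet, StripQ.core, SplusQ₁₁, W₁₁_eq, mem_setOf_eq]
  push_cast
  rfl

/-- **`covers` by certificate**: un-excluded list `BQ₁₁ :: stair`, no band, tiles `cover`. [folklore] -/
theorem covers_of_cert (stair cover : List BoxQ) (c : CoverCert)
    (h : (c.run (BQ₁₁ :: stair) none WQ₁₁ cover).isSome = true) :
    W₁₁ \ (B₁₁ ∪ ⋃ Q ∈ stair, Q.toSet) ⊆ ⋃ Q ∈ cover, Q.toSet := by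
  have h' := CoverCert.diff_subset_of_run (BQ₁₁ :: stair) WQ₁₁ cover c h
  rw [W₁₁_eq, B₁₁_eq]
  intro p hp
  refine h' ⟨hp.1, fun hu => hp.2 ?_⟩
  rw [mem_iUnion₂] at hu
  obtain ⟨Q, hQ, hpQ⟩ := hu
  rcases List.mem_cons.mp hQ with rfl | hQ'
  · exact Or.inl hpQ
  · exact Or.inr (mem_iUnion₂.mpr ⟨Q, hQ', hpQ⟩)

/-- **`stair_sup` by certificate**: un-excluded list `stair`, band `SQ₁₁`, no tiles. [folklore] -/
theorem stair_sup_of_cert (stair : List BoxQ) (c : CoverCert)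
    (h : (c.run stair (some SQ₁₁) WQ₁₁ []).isSome = true) : S₁₁ ⊆ ⋃ Q ∈ stair, Q.toSet := by
  rw [S₁₁_eq]
  exact CoverCert.band_subset_of_run stair SQ₁₁ WQ₁₁ c h

/-- **`stair_sub` by check**: four-corner membership in the convex envelope. [folklore] -/
theorem stair_sub_of_check (stair : List BoxQ) (h : stairSubCheck WQ₁₁ SplusQ₁₁ stair = true) :
    (⋃ Q ∈ stair, Q.toSet) ⊆ S₁₁plus := by
  rw [S₁₁plus_eq]
  exact iUnion_subset_of_stairSubCheck h

/-- **`StripCertificatesL11 stair cover` from the three rational certificates and the `excluded` clauses.**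
[folklore] -/
theorem stripCertificatesL11_of_certs {stair cover : List BoxQ} (cSup cCov : CoverCert)
    (hsup : (cSup.run stair (some SQ₁₁) WQ₁₁ []).isSome = true)
    (hsub : stairSubCheck WQ₁₁ SplusQ₁₁ stair = true)
    (hcov : (cCov.run (BQ₁₁ :: stair) none WQ₁₁ cover).isSome = true)
    (hex : ∀ Q ∈ cover, BoxExcluded Q.toSet) : StripCertificatesL11 stair cover :=
  ⟨stair_sup_of_cert stair cSup hsup, stair_sub_of_check stair hsub, covers_of_cert stair cover cCov hcov,
    hex⟩

/-- Smoke test of `stairSubCheck` on ONE plausible staircase box (`decide +kernel`): the 2⁻⁹-column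
`[1067/2048, 1071/2048] × [2872/2048, 3015/2048]` (ε-ends = the band's ends over the column rounded OUTWARD to
`2⁻¹¹ℤ`) lies in `W₁₁` with its corners in `S₁₁plus`. A shape test, not a staircase of record. [folklore] -/
theorem stairSubCheck_smoke :
    stairSubCheck WQ₁₁ SplusQ₁₁ [⟨1067 / 2048, 1071 / 2048, 2872 / 2048, 3015 / 2048⟩] = true := by
  decide +kernel

/-- Smoke test of the `outS` leaves (`decide +kernel`): the window cut at `Δσ = 1067/2048 < 521/1000` — the left
part is strictly left of the band (`outS 0`); the right column cut at `Δε = 11/8` and `25/16`: bottom strictly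
below the band (`outS 2`), top strictly above it (`outS 1`), middle inside the single un-excluded box
`[1067/2048, 107/200] × [11/8, 25/16]` (`inU 0`). A shape test of a `stair_sup` certificate, not a staircase of
record (that box is far wider than the envelope allows). [folklore] -/
theorem stairSup_smoke :
    ((CoverCert.splitσ (1067 / 2048) (.outS 0)
        (.splitε (11 / 8) (.outS 2) (.splitε (25 / 16) (.inU 0) (.outS 1)))).run
      [⟨1067 / 2048, 107 / 200, 11 / 8, 25 / 16⟩] (some SQ₁₁) WQ₁₁ []).isSome = true := by
  decide +kernel


/-! ### K4 (a) / K1 face shapes (PRE-REG v5 AMEND-7 (O3)/(O4)): a certified FACE LAYER of the window -/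

/-- The face layers `L_s(d) := {p ∈ W₁₁ : dist(p, s) ≤ d}` of PRE-REG v5 AMEND-7 (O4) as rational boxes, for the
four sides `s` of `W₁₁` and a rational depth `d` (hash-rowed, `≥ 2⁻⁹`, before the face is keyed): left, right,
bottom, top. [folklore] -/
def layerLeft (d : ℚ) : BoxQ := ⟨101 / 200, 101 / 200 + d, 6 / 5, 8 / 5⟩

/-- The right face layer `[107/200 − d, 107/200] × [6/5, 8/5]`. [folklore] -/
def layerRight (d : ℚ) : BoxQ := ⟨107 / 200 - d, 107 / 200, 6 / 5, 8 / 5⟩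

/-- The bottom face layer `[101/200, 107/200] × [6/5, 6/5 + d]`. [folklore] -/
def layerBottom (d : ℚ) : BoxQ := ⟨101 / 200, 107 / 200, 6 / 5, 6 / 5 + d⟩

/-- The top face layer `[101/200, 107/200] × [8/5 − d, 8/5]`. [folklore] -/
def layerTop (d : ℚ) : BoxQ := ⟨101 / 200, 107 / 200, 8 / 5 - d, 8 / 5⟩

/-- For `d ≤ 3/100` (layers inside the window) the left layer is the page's
`L_left(d) = {p ∈ W₁₁ : p.1 − 101/200 ≤ d}` (distance to the left side). The other three sides are the same
computation. [folklore] -/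
theorem layerLeft_toSet {d : ℚ} (hd : d ≤ 3 / 100) :
    (layerLeft d).toSet = {p ∈ W₁₁ | p.1 - 101 / 200 ≤ (d : ℝ)} := by
  have hd' : ((d : ℚ) : ℝ) ≤ ((3 / 100 : ℚ) : ℝ) := by exact_mod_cast hd
  push_cast at hd'
  ext ⟨σ, ε⟩
  simp only [layerLeft, BoxQ.toSet, W₁₁, mem_prod, mem_Icc]
  push_cast
  constructor
  · rintro ⟨⟨h1, h2⟩, h3, h4⟩
    exact ⟨⟨⟨h1, by linarith⟩, h3, h4⟩, by linarith⟩
  · rintro ⟨⟨⟨h1, h2⟩, h3, h4⟩, h5⟩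
    exact ⟨⟨h1, by linarith⟩, h3, h4⟩

/-- **Face theorem shape of K4 (a)** (AMEND-7 (O4): «a COMPLETE CERTIFIED FACE := `L_s(d) \ U₁₁` covered by U-1 PASS
boxes with the landed theorem `IsingEnclosure W₁₁ (U₁₁ ∪ (W₁₁ \ L_s(d)))`», `U₁₁ = B₁₁ ∪ S₁₁^□`): a cover
certificate run on the LAYER `L` (any rational box; the four `layer…` boxes are the page's) against the
un-excluded list `BQ₁₁ :: stair`, plus the `excluded` clauses of its tiles, gives exactly that enclosure — through
`isingStrip_L11_of_cover`. CONDITIONAL on the `excluded` clauses like every theorem here. [folklore] -/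
theorem face_of_cert (L : BoxQ) (stair cover : List BoxQ) (c : CoverCert)
    (h : (c.run (BQ₁₁ :: stair) none L cover).isSome = true) (hex : ∀ Q ∈ cover, BoxExcluded Q.toSet) :
    IsingEnclosure W₁₁ ((B₁₁ ∪ ⋃ Q ∈ stair, Q.toSet) ∪ (W₁₁ \ L.toSet)) := by
  refine isingStrip_L11_of_cover cover (fun p hp => ?_) hex
  have h' := CoverCert.diff_subset_of_run (BQ₁₁ :: stair) L cover c h
  obtain ⟨hW, hU⟩ := hp
  simp only [mem_union, mem_sdiff, not_or, not_and, not_not] at hU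
  obtain ⟨⟨hB, hS⟩, hL⟩ := hU
  refine h' ⟨hL hW, fun hu => ?_⟩
  rw [mem_iUnion₂] at hu
  obtain ⟨Q, hQ, hpQ⟩ := hu
  rcases List.mem_cons.mp hQ with rfl | hQ'
  · exact hB (B₁₁_eq ▸ hpQ)
  · exact hS (mem_iUnion₂.mpr ⟨Q, hQ', hpQ⟩)


/-- **Face theorem with the staircase PINNED** (referee-1 g2, F-g2-2: `face_of_cert` alone carries no staircase
bound, so a «fat» staircase would give a true but vacuous enclosure): the instance of record supplies the same
`stair_sup` / `stair_sub` certificates as the strip, and a reader cites the ENVELOPE form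
`IsingEnclosure W₁₁ ((B₁₁ ∪ S₁₁plus) ∪ (W₁₁ \ L))` — staircase-free — together with `S₁₁ ⊆ ⋃ stair`. [folklore] -/
theorem face_envelope_of_certs (L : BoxQ) {stair cover : List BoxQ} (cSup cFace : CoverCert)
    (hsup : (cSup.run stair (some SQ₁₁) WQ₁₁ []).isSome = true)
    (hsub : stairSubCheck WQ₁₁ SplusQ₁₁ stair = true)
    (hcov : (cFace.run (BQ₁₁ :: stair) none L cover).isSome = true) (hex : ∀ Q ∈ cover, BoxExcluded Q.toSet) :
    S₁₁ ⊆ (⋃ Q ∈ stair, Q.toSet) ∧ (⋃ Q ∈ stair, Q.toSet) ⊆ S₁₁plus ∧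
      IsingEnclosure W₁₁ ((B₁₁ ∪ ⋃ Q ∈ stair, Q.toSet) ∪ (W₁₁ \ L.toSet)) ∧
        IsingEnclosure W₁₁ ((B₁₁ ∪ S₁₁plus) ∪ (W₁₁ \ L.toSet)) := by
  have hs := stair_sub_of_check stair hsub
  have hf := face_of_cert L stair cover cFace hcov hex
  exact ⟨stair_sup_of_cert stair cSup hsup, hs, hf,
    hf.mono Subset.rfl (union_subset_union_left _ (union_subset_union_right B₁₁ hs))⟩

/-- Smoke test of the face shape (`decide +kernel`): the left layer of depth `2⁻⁹` is a single box left of `B₁₁`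
(`101/200 + 1/512 < 263/512`), so ONE tile equal to the layer certifies the run (shape test; that tile is not a
certificate of record). [folklore] -/
theorem face_smoke :
    ((CoverCert.tile).run (BQ₁₁ :: []) none (layerLeft (1 / 512)) [layerLeft (1 / 512)]).isSome = true := by
  decide +kernel

end StripL11

end Summit.CriticalPhenomena.Ising3D
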